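import Summits.ValiantsHypothesis.ValiantsHypothesis.Theorems.KPlusLogSqLawTropicalBBlockOrder
import Summits.ValiantsHypothesis.ValiantsHypothesis.Theorems.KPlusLogSqLawTropicalBConvexPositionArc

/-!
# Route «KPlusLogSqLaw», crux `TropicalB` (stmt-ValiantsHypothesis-19771) — SUB-ADDITIVITY BY DISTINCT HALVES:
# at every column cut, (chain length) + (#row images met) ≤ (#distinct left halves) + (#distinct right halves)

HONEST FRAMING.  Helper file of the object-search cell `pub-symmetroid` (seat val-sym-trop-p2 g3) for the crux
`Summit.ValiantsHypothesis.ValiantsHypothesis.Theses.KPlusLogSqLaw.TropicalB` (ledger item `stmt-ValiantsHypothesis-19771`, route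
`KPlusLogSqLaw`; registered stubs `stub_tropThin` / `stub_tropFat` of `Cruxes/TropicalB/Lines/birth.lean`, each ⟺ the crux), landed
`--supports`; it does NOT close the item and asserts nothing about `TropicalB` in its window, `WeakLifting`, `KPlusLogSqLaw`,
`MatrixDescartes` (stmt-ValiantsHypothesis-18050) or `VP ≠ VNP`.  A STRUCTURAL inequality for chains of unique optima (`IsDominant`) of
an ARBITRARY dominance design at strictly increasing integer slopes with consecutive terms distinct: no support class, no exponent regime,
no sign condition.

THE INEQUALITY (`Halves.halves_subadditive`).  Fix any set `U` of columns and a dominant chain `p 0, …, p n`.  Let `I` be the number of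
distinct row images `σ_k(U)` met along the chain, `H` the number of distinct LEFT HALVES `restr U (p k)` and `H'` the number of distinct
RIGHT HALVES `restr Uᶜ (p k)` ((row, class) data on `U`, resp. off `U`).  Then

  `(n + 1) + I ≤ H + H'`.

So a long chain is DIVERSE ON HALVES at every cut: at least `(n + 1 + I)/2` distinct half-terms on one side.  Proof (ERAS, this seat's
`BlockOrder.era_convex`): call an index NEW for a statistic if its value did not occur at an earlier index.  An index with a new row image
is new for both halves (a half determines the image).  An index `k` whose image is old is new for at least one half: otherwise some
`a < k` carries the left half of `p k` and some `b < k` its right half, both inside the image class of `k`; by `era_convex` the later of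
`a, b` carries BOTH halves of `p k`, i.e. equals `p k` — but chain terms are pairwise distinct.  Counting new indices gives the claim
(`card_new_le_card_image`, `card_image_le_card_new`).

RELATION TO THE TREE.  This is the divide step of val-sym-trop-p5 / trop-p1's engine (`IntervalOpt.card_optRestr_union_le` →
`chain_split` → `designRowD_of_visitedStates`) with the STATE FAMILY REMOVED from the statement: `chain_split` bounds the terms of each
image class by the half-FORMAT maxima `B₁ + B₂ + 1` and pays the factor `#𝓡` (visited states); here each image class is charged only for
the half-terms it actually uses, and the classes partition the half-terms, so the visited-state factor disappears into `H + H'`.  Since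
every occurring half with image `R` is a dominant term of the square sub-design `U × R`, `H ≤ #𝓡·(B₁ + 1)` recovers the tree's form.
Located reading (refuter calibration, no claim on `TropicalB`): a super-quasi-polynomial family must show super-quasi-polynomially many
DISTINCT HALF-TERMS at every balanced cut — a cheap diagnostic for candidate constructions.  [folklore: Gusfield's divide and conquer;
the packaging is the cell's]
-/

-- `Summit.ValiantsHypothesis.ValiantsHypothesis.…` repeats a component by the D-0017 layout
-- (single-conjunct summit), which the `dupNamespace` linter flags; the name is mandated.
set_option linter.dupNamespace false
set_option autoImplicit false

namespace Summit.ValiantsHypothesis.ValiantsHypothesis.Theorems.KPlusLogSqLaw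

open Summit.ValiantsHypothesis.ValiantsHypothesis.Theorems.MatrixDescartes.Negative
open scoped BigOperators
open Finset

namespace Halves

variable {m K : ℕ}

/-! ## 1. Counting distinct values by new indices -/

/-- indices that are NEW for the statistic `f` (their value did not occur at an earlier index) carry pairwise distinct values, so a
set of new indices below `N` is at most as large as the set of values of `f` below `N`. [folklore] -/
theorem card_new_le_card_image {α : Type*} [DecidableEq α] (f : ℕ → α) (N : ℕ) (S : Finset ℕ)
    (hS : ∀ k ∈ S, k < N ∧ ∀ k' < k, f k' ≠ f k) : S.card ≤ ((range N).image f).card := by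
  refine Finset.card_le_card_of_injOn f (fun k hk => ?_) ?_
  · exact Finset.mem_image_of_mem f (Finset.mem_range.2 (hS k hk).1)
  · intro k₁ hk₁ k₂ hk₂ h
    have n1 := (hS k₁ (Finset.mem_coe.1 hk₁)).2
    have n2 := (hS k₂ (Finset.mem_coe.1 hk₂)).2
    by_contra hne
    rcases lt_or_gt_of_ne hne with hlt | hlt
    · exact n2 k₁ hlt h
    · exact n1 k₂ hlt h.symm

/-- every value has a first (new) index, so a set containing all new indices below `N` is at least as large as the set of values of
`f` below `N`. [folklore] -/
theorem card_image_le_card_new {α : Type*} [DecidableEq α] (f : ℕ → α) (N : ℕ) (S : Finset ℕ)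
    (hS : ∀ k < N, (∀ k' < k, f k' ≠ f k) → k ∈ S) : ((range N).image f).card ≤ S.card := by
  classical
  -- first occurrence of a value
  let g : α → ℕ := fun y => if h : ∃ k, k < N ∧ f k = y then Nat.find h else 0
  refine Finset.card_le_card_of_injOn g (fun y hy => ?_) ?_
  · obtain ⟨k, hk, hfk⟩ := Finset.mem_image.1 hy
    have hex : ∃ k, k < N ∧ f k = y := ⟨k, Finset.mem_range.1 hk, hfk⟩
    have hg : g y = Nat.find hex := dif_pos hex
    obtain ⟨h1, h2⟩ := Nat.find_spec hex
    rw [hg]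
    refine hS _ h1 fun k' hk' heq => ?_
    have := Nat.find_min hex hk'
    exact this ⟨lt_trans hk' h1, by rw [heq, h2]⟩
  · intro y₁ hy₁ y₂ hy₂ h
    obtain ⟨k₁, hk₁, hf₁⟩ := Finset.mem_image.1 (Finset.mem_coe.1 hy₁)
    obtain ⟨k₂, hk₂, hf₂⟩ := Finset.mem_image.1 (Finset.mem_coe.1 hy₂)
    have hex₁ : ∃ k, k < N ∧ f k = y₁ := ⟨k₁, Finset.mem_range.1 hk₁, hf₁⟩
    have hex₂ : ∃ k, k < N ∧ f k = y₂ := ⟨k₂, Finset.mem_range.1 hk₂, hf₂⟩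
    have e1 : g y₁ = Nat.find hex₁ := dif_pos hex₁
    have e2 : g y₂ = Nat.find hex₂ := dif_pos hex₂
    have s1 := (Nat.find_spec hex₁).2
    have s2 := (Nat.find_spec hex₂).2
    have h' : Nat.find hex₁ = Nat.find hex₂ := by rw [← e1, ← e2]; exact h
    rw [← s1, ← s2, h']

/-! ## 2. Halves, images, and the inequality -/

/-- a permutation maps the complement of `U` onto the complement of the image of `U`. [folklore] -/
theorem image_compl_eq (σ : Equiv.Perm (Fin m)) (U : Finset (Fin m)) : Uᶜ.image σ = (U.image σ)ᶜ := by
  classical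
  ext r
  simp only [Finset.mem_image, Finset.mem_compl]
  constructor
  · rintro ⟨c, hc, rfl⟩ ⟨c', hc', e⟩
    exact hc (σ.injective e ▸ hc')
  · intro h
    refine ⟨σ.symm r, fun hc => h ⟨σ.symm r, hc, σ.apply_symm_apply r⟩, σ.apply_symm_apply r⟩

/-- equal halves on `U` give equal row images of `U`. [folklore] -/
theorem image_eq_of_restr_eq (U : Finset (Fin m)) {x y : Equiv.Perm (Fin m) × (Fin m → Fin K)}
    (h : IntervalOpt.restr U x = IntervalOpt.restr U y) : U.image x.1 = U.image y.1 :=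
  Finset.image_congr fun i hi => (IntervalOpt.restr_eq_iff.1 h i (Finset.mem_coe.1 hi)).1

/-- equal halves off `U` also give equal row images of `U` (complements). [folklore] -/
theorem image_eq_of_restr_compl_eq (U : Finset (Fin m)) {x y : Equiv.Perm (Fin m) × (Fin m → Fin K)}
    (h : IntervalOpt.restr Uᶜ x = IntervalOpt.restr Uᶜ y) : U.image x.1 = U.image y.1 := by
  have h1 := image_eq_of_restr_eq Uᶜ h
  rw [image_compl_eq, image_compl_eq] at h1
  exact compl_injective h1

/-- a term is its two halves. [folklore] -/
theorem eq_of_halves_eq (U : Finset (Fin m)) {x y : Equiv.Perm (Fin m) × (Fin m → Fin K)}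
    (h : IntervalOpt.restr U x = IntervalOpt.restr U y) (h' : IntervalOpt.restr Uᶜ x = IntervalOpt.restr Uᶜ y) : x = y :=
  IntervalOpt.eq_of_restr_eq_of_agreeOut h fun i hi => IntervalOpt.restr_eq_iff.1 h' i (Finset.mem_compl.2 hi)

variable (d : Fin K → ℕ) (v ε : Fin m → Fin m → Fin K → ℤ) {n : ℕ} (θ : ℕ → ℤ)
  (p : ℕ → Equiv.Perm (Fin m) × (Fin m → Fin K))

/-- **SUB-ADDITIVITY BY DISTINCT HALVES.**  Along a dominant chain `p 0, …, p n` (integer slopes increasing step by step, consecutive terms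
distinct) and for every column set `U`:
`(n + 1) + #{row images of U met} ≤ #{distinct halves on U} + #{distinct halves off U}`. [folklore] -/
theorem halves_subadditive (hdom : ∀ k ≤ n, IsDominant d v ε (θ k) (p k)) (hθ : ∀ k < n, θ k < θ (k + 1))
    (hne : ∀ k < n, p k ≠ p (k + 1)) (U : Finset (Fin m)) :
    (n + 1) + ((range (n + 1)).image fun k => U.image (p k).1).card ≤
      ((range (n + 1)).image fun k => IntervalOpt.restr U (p k)).card +
        ((range (n + 1)).image fun k => IntervalOpt.restr Uᶜ (p k)).card := by
  classical
  let img : ℕ → Finset (Fin m) := fun k => U.image (p k).1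
  let L : ℕ → (Fin m → Option (Fin m × Fin K)) := fun k => IntervalOpt.restr U (p k)
  let R : ℕ → (Fin m → Option (Fin m × Fin K)) := fun k => IntervalOpt.restr Uᶜ (p k)
  let A := (range (n + 1)).filter fun k => ∀ k' < k, L k' ≠ L k
  let B := (range (n + 1)).filter fun k => ∀ k' < k, R k' ≠ R k
  let C := (range (n + 1)).filter fun k => ∀ k' < k, img k' ≠ img k
  -- chain terms are pairwise distinct
  have hdist : ∀ {j k : ℕ}, j < k → k ≤ n → p j ≠ p k :=
    fun hjk hk => ConvexPosition.chain_ne d v ε θ p hdom hθ hne hjk hk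
  -- (1) a new image is new for both halves
  have hCA : C ⊆ A ∩ B := by
    intro k hk
    obtain ⟨hkr, hnew⟩ := Finset.mem_filter.1 hk
    refine Finset.mem_inter.2 ⟨Finset.mem_filter.2 ⟨hkr, fun k' hk' h => ?_⟩, Finset.mem_filter.2 ⟨hkr, fun k' hk' h => ?_⟩⟩
    · exact hnew k' hk' (image_eq_of_restr_eq U h)
    · exact hnew k' hk' (image_eq_of_restr_compl_eq U h)
  -- (2) every index is new for at least one half
  have hAB : range (n + 1) ⊆ A ∪ B := by
    intro k hkr
    have hkn : k ≤ n := Nat.lt_succ_iff.1 (Finset.mem_range.1 hkr)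
    by_contra hk
    rw [Finset.mem_union, not_or] at hk
    have ha : ¬ ∀ k' < k, L k' ≠ L k := fun h => hk.1 (Finset.mem_filter.2 ⟨hkr, h⟩)
    have hb : ¬ ∀ k' < k, R k' ≠ R k := fun h => hk.2 (Finset.mem_filter.2 ⟨hkr, h⟩)
    push Not at ha hb
    obtain ⟨a, hak, hLa⟩ := ha
    obtain ⟨b, hbk, hRb⟩ := hb
    -- the halves carried at `a` (on `U`) and at `b` (off `U`) are those of `p k`
    have hLa' : IntervalOpt.restr U (p a) = IntervalOpt.restr U (p k) := hLa
    have hRb' : IntervalOpt.restr Uᶜ (p b) = IntervalOpt.restr Uᶜ (p k) := hRb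
    -- images of `U` at `a`, `b`, `k` coincide
    have ia : U.image (p a).1 = U.image (p k).1 := image_eq_of_restr_eq U hLa'
    have ib : U.image (p b).1 = U.image (p k).1 := image_eq_of_restr_compl_eq U hRb'
    rcases Nat.lt_or_ge a b with hab | hba
    · -- the later index `b` also carries the left half of `p k`
      have hLb : IntervalOpt.restr U (p b) = IntervalOpt.restr U (p k) := by
        have e := BlockOrder.chain_era_convex θ p hdom hθ hab hbk hkn U (by rw [ia, ib]) hLa'
        exact e.trans hLa'
      exact hdist hbk hkn (eq_of_halves_eq U hLb hRb')
    · rcases hba.lt_or_eq with hba | hba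
      · -- the later index `a` also carries the right half of `p k` (window `Uᶜ`)
        have hRa : IntervalOpt.restr Uᶜ (p a) = IntervalOpt.restr Uᶜ (p k) := by
          have himg' : Uᶜ.image (p b).1 = Uᶜ.image (p a).1 := by
            rw [image_compl_eq, image_compl_eq, ib, ia]
          have e := BlockOrder.chain_era_convex θ p hdom hθ hba hak hkn Uᶜ himg' hRb'
          exact e.trans hRb'
        exact hdist hak hkn (eq_of_halves_eq U hLa' hRa)
      · subst hba
        exact hdist hak hkn (eq_of_halves_eq U hLa' hRb')
  -- (3) count
  have c1 : A.card + B.card = (A ∪ B).card + (A ∩ B).card := (Finset.card_union_add_card_inter A B).symm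
  have c2 : (range (n + 1)).card ≤ (A ∪ B).card := Finset.card_le_card hAB
  have c3 : C.card ≤ (A ∩ B).card := Finset.card_le_card hCA
  have c4 : ((range (n + 1)).image img).card ≤ C.card :=
    card_image_le_card_new img (n + 1) C fun k hk hnew => Finset.mem_filter.2 ⟨Finset.mem_range.2 hk, hnew⟩
  have c5 : A.card ≤ ((range (n + 1)).image L).card :=
    card_new_le_card_image L (n + 1) A fun k hk =>
      ⟨Finset.mem_range.1 (Finset.mem_filter.1 hk).1, (Finset.mem_filter.1 hk).2⟩
  have c6 : B.card ≤ ((range (n + 1)).image R).card :=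
    card_new_le_card_image R (n + 1) B fun k hk =>
      ⟨Finset.mem_range.1 (Finset.mem_filter.1 hk).1, (Finset.mem_filter.1 hk).2⟩
  rw [Finset.card_range] at c2
  show (n + 1) + ((range (n + 1)).image img).card ≤ ((range (n + 1)).image L).card + ((range (n + 1)).image R).card
  omega

/-- **diversity corollary**: a dominant chain with consecutive terms distinct has, at every column cut, more than `(n + 1)/2` distinct
half-terms on one of the two sides. [folklore] -/
theorem exists_many_halves (hdom : ∀ k ≤ n, IsDominant d v ε (θ k) (p k)) (hθ : ∀ k < n, θ k < θ (k + 1))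
    (hne : ∀ k < n, p k ≠ p (k + 1)) (U : Finset (Fin m)) :
    n + 2 ≤ 2 * ((range (n + 1)).image fun k => IntervalOpt.restr U (p k)).card ∨
      n + 2 ≤ 2 * ((range (n + 1)).image fun k => IntervalOpt.restr Uᶜ (p k)).card := by
  classical
  have h := halves_subadditive d v ε θ p hdom hθ hne U
  have hI : 1 ≤ ((range (n + 1)).image fun k => U.image (p k).1).card :=
    Finset.card_pos.2 ⟨U.image (p 0).1, Finset.mem_image_of_mem _ (Finset.mem_range.2 (Nat.succ_pos n))⟩
  omega

end Halves

end Summit.ValiantsHypothesis.ValiantsHypothesis.Theorems.KPlusLogSqLaw
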